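import Summits.QuantumFields.YangMills.Theorems.CurvatureBoostCovariance.Negative.BetaZeroMoments
import Summits.QuantumFields.YangMills.Theorems.CurvatureBoostCovariance.Negative.Unbundled
import Summits.QuantumFields.YangMills.Theorems.HypercubicLimit.Negative.NonabelianLoadBearing

/-!
# `CurvatureBoostCovariance` — negative-side support VI: the `β ≡ 0` collapse of the lattice tie

Third file of the `β ≡ 0` COLLAPSE for crux `stmt-QuantumFields-9663` (work file §6).

* `latticeSchwinger_beta_zero`: EXACT formula for the curvature `n`-point function at a scheme step with
  `β_k = 0`, `n < side_k`, on every real tensor vanishing at non-injective site families (off-diagonal tensors):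
  `(c_k (6 d₀ − m_k))ⁿ ∏ᵢ a_k⁴ Σ_{y ∈ box} fᵢ(a_k y)` — for EVERY `c_k, m_k, a_k, L_k` and every faithful `ρ`.
* `tie_beta_zero_factorises`: a family tied to a `β ≡ 0` scheme satisfies `S₁ n (⊗ fᵢ) = ∏ S₁ 1 (fᵢ)` on
  off-diagonal real tensors — a c-number field (never `IsNontrivial`).
* `apply_linActMulti_eq_of_beta_zero`: for such a family the conclusion of the crux, for EVERY linear isometry,
  reduces to invariance of the one-point distribution (translation invariant by `W₁`).
-/

noncomputable section

open MeasureTheory Filter Topology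
open Literature.Probability.LatticeModels (Torus.proj box)
open Literature.MathematicalPhysics.AQFT Literature.MathematicalPhysics.QuantumLattice
open Literature.MathematicalPhysics.QuantumFieldTheory

namespace Summit.QuantumFields.YangMills.Theorems.CurvatureBoostCovariance.Negative
/-! ## Stage 5: the lattice `n`-point functions of the curvature at `β = 0` -/

section LatticeSchwingerBetaZero

variable {G : Type} [Group G] [TopologicalSpace G] [IsTopologicalGroup G] [CompactSpace G]
  [MeasurableSpace G] [BorelSpace G]

open scoped SchwartzMap

omit [Group G] [TopologicalSpace G] [IsTopologicalGroup G] [CompactSpace G] [BorelSpace G] in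
/-- The periodic lift is measurable. -/
theorem measurable_torusLift'' (S : ℕ) : Measurable (torusLift (d := 4) (G := G) S) :=
  measurable_pi_lambda _ fun _ => measurable_pi_apply _

/-- **`latticeSchwinger` at `β = 0` — EXACT formula.** For a scheme step `k` with `β_k = 0`,
`n < side_k`, any lattice representation `r` and real test functions `f i` whose tensor
product vanishes at every non-injective family of box sites (e.g. an off-diagonal real tensor),
the lattice `n`-point function of the curvature string is the `n`-point function of the
CONSTANT field `κ_k = c_k (6 d₀ − m_k)`:
`⟨∏ᵢ Φ(fᵢ)⟩_k = κ_kⁿ ∏ᵢ a_k⁴ Σ_{y ∈ box} fᵢ(a_k y)`. -/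
theorem latticeSchwinger_beta_zero (r : LatticeRep G) (sch : SpeciesScheme (YMSpecies G)) (k : ℕ)
    (hβ : sch.β k = 0) {n : ℕ} (hn : n < sch.side k) (f : Fin n → 𝓢(EuclideanSpace ℝ (Fin 4), ℝ))
    (hf : ∀ Y : Fin n → Fin 4 → ℤ, (∀ i, Y i ∈ box 4 (sch.L k)) → ¬ Function.Injective Y →
      ∏ i, f i (sch.a k • siteToE (Y i)) = 0) :
    latticeSchwinger r.ρ sch (fun s => s.F) k n (fun _ => r.curvature) f =
      (sch.c r.curvature k * (6 * haarTraceRe r.ρ - sch.m r.curvature k)) ^ n *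
        ∏ i, (sch.a k ^ 4 * ∑ y ∈ box 4 (sch.L k), f i (sch.a k • siteToE y)) := by
  classical
  haveI : SecondCountableTopology G :=
    (r.continuous.isClosedEmbedding r.injective).isEmbedding.secondCountableTopology
  have hcurv : r.curvature.F = actionDensity r.ρ := rfl
  unfold latticeSchwinger
  dsimp only
  rw [hβ, Theorems.LatticeGapOnTrajectory.Negative.wilsonMeasure_zero_coupling]
  simp only [hcurv, smearedLatticeField]
  -- Step 1: pull the constants `c a⁴` out of the product and expand the product of sums
  have hstep1 : ∀ U : GaugeConfig 4 (sch.side k) G,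
      (∏ i, sch.c r.curvature k * sch.a k ^ 4 * ∑ y ∈ box 4 (sch.L k), f i (sch.a k • siteToE y) *
        (actionDensity r.ρ (configShift (-y) (torusLift (sch.side k) U)) - sch.m r.curvature k)) =
      (sch.c r.curvature k * sch.a k ^ 4) ^ n *
        ∑ Y ∈ Fintype.piFinset (fun _ : Fin n => box 4 (sch.L k)),
          (∏ i, f i (sch.a k • siteToE (Y i))) *
            ∏ i, (actionDensity r.ρ (configShift (-(Y i)) (torusLift (sch.side k) U)) -
              sch.m r.curvature k) := by
    intro U
    rw [Finset.prod_mul_distrib, Finset.prod_const, Finset.card_univ, Fintype.card_fin,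
      Finset.prod_univ_sum]
    congr 1
    refine Finset.sum_congr rfl fun Y _ => ?_
    rw [← Finset.prod_mul_distrib]
  simp_rw [hstep1]
  -- integrability of each summand
  obtain ⟨CA, hCA⟩ := r.curvature.bounded
  have hmeasAD : ∀ y : Fin 4 → ℤ, Measurable fun U : GaugeConfig 4 (sch.side k) G =>
      actionDensity r.ρ (configShift (-y) (torusLift (sch.side k) U)) := fun y =>
    r.curvature.measurable.comp ((configShift (-y)).measurable.comp (measurable_torusLift'' _))
  have hint : ∀ Y : Fin n → Fin 4 → ℤ, Integrable (fun U : GaugeConfig 4 (sch.side k) G =>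
      (∏ i, f i (sch.a k • siteToE (Y i))) *
        ∏ i, (actionDensity r.ρ (configShift (-(Y i)) (torusLift (sch.side k) U)) -
          sch.m r.curvature k)) (Measure.pi fun _ : Edge 4 (sch.side k) => haarProbability G) := by
    intro Y
    refine Integrable.const_mul ?_ _
    refine Integrable.of_bound (Finset.measurable_prod _ fun i _ =>
      (hmeasAD (Y i)).sub measurable_const).aestronglyMeasurable ((CA + |sch.m r.curvature k|) ^ n)
      (ae_of_all _ fun U => ?_)
    rw [Real.norm_eq_abs, Finset.abs_prod]
    calc ∏ i, |actionDensity r.ρ (configShift (-(Y i)) (torusLift (sch.side k) U)) - sch.m r.curvature k|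
        ≤ ∏ _i : Fin n, (CA + |sch.m r.curvature k|) :=
          Finset.prod_le_prod (fun i _ => abs_nonneg _) fun i _ =>
            (abs_sub _ _).trans (add_le_add (hCA _) le_rfl)
      _ = (CA + |sch.m r.curvature k|) ^ n := by
          rw [Finset.prod_const, Finset.card_univ, Fintype.card_fin]
  rw [integral_const_mul, integral_finsetSum _ fun Y _ => hint Y]
  -- Step 2: each summand integrates to `(∏ f) * Kⁿ`
  have hstep2 : ∀ Y ∈ Fintype.piFinset (fun _ : Fin n => box 4 (sch.L k)),
      ∫ U, (∏ i, f i (sch.a k • siteToE (Y i))) *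
          ∏ i, (actionDensity r.ρ (configShift (-(Y i)) (torusLift (sch.side k) U)) -
            sch.m r.curvature k) ∂(Measure.pi fun _ : Edge 4 (sch.side k) => haarProbability G) =
        (∏ i, f i (sch.a k • siteToE (Y i))) * (6 * haarTraceRe r.ρ - sch.m r.curvature k) ^ n := by
    intro Y hY
    have hYbox : ∀ i, Y i ∈ box 4 (sch.L k) := fun i => Fintype.mem_piFinset.1 hY i
    rw [integral_const_mul]
    by_cases hYinj : Function.Injective Y
    · congr 1
      refine integral_prod_actionDensity_sub r.ρ r.continuous Y (fun i j hij => hYinj ?_) hn _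
      exact proj_injOn_box (sch.L k) (hYbox i) (hYbox j) hij
    · rw [hf Y hYbox hYinj, zero_mul, zero_mul]
  rw [Finset.sum_congr rfl hstep2, ← Finset.sum_mul]
  have h2 := Finset.prod_univ_sum (fun _ : Fin n => box 4 (sch.L k))
    (fun i y => f i (sch.a k • siteToE y))
  rw [← h2]
  -- Step 3: algebra
  rw [Finset.prod_mul_distrib, Finset.prod_const, Finset.card_univ, Fintype.card_fin, mul_pow,
    mul_pow]
  ring

end LatticeSchwingerBetaZero


/-! ## Stage 6: consequences for the crux — a family tied to a `β ≡ 0` scheme is a c-number field -/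

section TieBetaZero

variable {G : Type} [Group G] [TopologicalSpace G] [IsTopologicalGroup G] [CompactSpace G]
  [MeasurableSpace G] [BorelSpace G]

open scoped SchwartzMap

omit [Group G] [TopologicalSpace G] [IsTopologicalGroup G] [CompactSpace G] [MeasurableSpace G]
  [BorelSpace G] in
/-- The half-sides of a species scheme tend to infinity (`a_k → 0`, `a_k L_k → ∞`). -/
theorem tendsto_L_atTop {ι : Type} (sch : SpeciesScheme ι) :
    Tendsto (fun k => (sch.L k : ℝ)) atTop atTop := by
  have ha : ∀ᶠ k in atTop, sch.a k ≤ 1 := sch.tendsto_a.eventually (eventually_le_nhds one_pos)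
  refine tendsto_atTop_mono' atTop ?_ sch.tendsto_L
  filter_upwards [ha] with k hk
  have hL : (0 : ℝ) ≤ sch.L k := Nat.cast_nonneg _
  calc sch.a k * sch.L k ≤ 1 * sch.L k := by gcongr
    _ = sch.L k := one_mul _

omit [Group G] [TopologicalSpace G] [IsTopologicalGroup G] [CompactSpace G] [MeasurableSpace G]
  [BorelSpace G] in
/-- Eventually `n < side_k`. -/
theorem eventually_lt_side {ι : Type} (sch : SpeciesScheme ι) (n : ℕ) :
    ∀ᶠ k in atTop, n < sch.side k := by
  have h := (tendsto_L_atTop sch).eventually_ge_atTop (n : ℝ)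
  filter_upwards [h] with k hk
  have hk' : n ≤ sch.L k := by exact_mod_cast hk
  show n < 2 * sch.L k + 1
  omega

/-- An off-diagonal real tensor vanishes at every non-injective family of (rescaled) sites. -/
theorem prod_eq_zero_of_not_injective {n : ℕ} {f : Fin n → 𝓢(EuclideanSpace ℝ (Fin 4), ℝ)}
    {F : 𝓢((Fin n → EuclideanSpace ℝ (Fin 4)), ℂ)} (hF : IsTensorOf F fun i => ofRealTest (f i))
    (hF' : IsOffDiagonal F) (a : ℝ) (Y : Fin n → Fin 4 → ℤ) (hY : ¬ Function.Injective Y) :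
    ∏ i, f i (a • siteToE (Y i)) = 0 := by
  have hmem : (fun i => a • siteToE (Y i)) ∈ coincidenceLocus n (EuclideanSpace ℝ (Fin 4)) := by
    simp only [Function.Injective, not_forall] at hY
    obtain ⟨i, j, hij, hne⟩ := hY
    exact ⟨i, j, hne, by simp [hij]⟩
  have h0 := hF'.apply_eq_zero hmem
  rw [hF] at h0
  simp only [ofRealTest_apply, ← Complex.ofReal_prod, Complex.ofReal_eq_zero] at h0
  exact h0


/-- **A family tied to a scheme with `β_k = 0` FREQUENTLY (e.g. `β ≡ 0`) is a C-NUMBER FIELD on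
off-diagonal real tensors**:
`S₁ n (f₁ ⊗ ⋯ ⊗ fₙ) = ∏ᵢ S₁ 1 (fᵢ)`, whatever `c_k, m_k, a_k, L_k` and whatever the faithful
representation `r` — so no `β ≡ 0` scheme can ever tie a non-trivial family, and for the crux
every `β ≡ 0` witness collapses (next theorem). -/
theorem tie_beta_zero_factorises (r : LatticeRep G) (sch : SpeciesScheme (YMSpecies G))
    (hβ : ∃ᶠ k in atTop, sch.β k = 0) {S₁ : SchwingerFamily (EuclideanSpace ℝ (Fin 4))}
    (htie : ∀ (n : ℕ), n ≠ 0 → ∀ (f : Fin n → 𝓢(EuclideanSpace ℝ (Fin 4), ℝ))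
      (F : 𝓢((Fin n → EuclideanSpace ℝ (Fin 4)), ℂ)), IsTensorOf F (fun i => ofRealTest (f i)) →
      IsOffDiagonal F → Tendsto (fun k : ℕ => ((latticeSchwinger r.ρ sch (fun s => s.F) k n
        (fun _ => r.curvature) f : ℝ) : ℂ)) atTop (𝓝 (S₁ n F)))
    {n : ℕ} (hn : n ≠ 0) (f : Fin n → 𝓢(EuclideanSpace ℝ (Fin 4), ℝ))
    (F : 𝓢((Fin n → EuclideanSpace ℝ (Fin 4)), ℂ)) (hF : IsTensorOf F fun i => ofRealTest (f i))
    (hF' : IsOffDiagonal F) (F₁ : Fin n → 𝓢((Fin 1 → EuclideanSpace ℝ (Fin 4)), ℂ))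
    (hF₁ : ∀ i, IsTensorOf (F₁ i) fun _ => ofRealTest (f i)) :
    S₁ n F = ∏ i, S₁ 1 (F₁ i) := by
  have hlimn := htie n hn f F hF hF'
  have hlim1 : ∀ i, Tendsto (fun k : ℕ => ((latticeSchwinger r.ρ sch (fun s => s.F) k 1
      (fun _ => r.curvature) (fun _ => f i) : ℝ) : ℂ)) atTop (𝓝 (S₁ 1 (F₁ i))) := fun i =>
    htie 1 one_ne_zero (fun _ => f i) (F₁ i) (hF₁ i) (HypercubicLimit.Negative.isOffDiagonal_fin_one _)
  have hprod := tendsto_finsetProd Finset.univ fun i _ => hlim1 i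
  refine tendsto_nhds_unique_of_frequently_eq hlimn hprod (hβ.mp ?_)
  filter_upwards [eventually_lt_side sch n, eventually_lt_side sch 1] with k hkn hk1 hβk
  rw [latticeSchwinger_beta_zero r sch k hβk hkn f
    (fun Y _ hY => prod_eq_zero_of_not_injective hF hF' _ Y hY)]
  simp_rw [latticeSchwinger_beta_zero r sch k hβk hk1 (fun _ => f _)
    (fun Y _ hY => (hY (Function.injective_of_subsingleton Y)).elim)]
  push_cast
  simp only [Finset.univ_unique, Finset.prod_singleton, pow_one]
  simp only [Finset.prod_mul_distrib, Finset.prod_const, Finset.card_univ, Fintype.card_fin, mul_pow]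

/-- **No counterexample from ANY scheme with `β_k = 0` frequently** (arbitrary `c_k, m_k, a_k, L_k`,
any `r`; so a counterexample needs `β_k ≠ 0` for ALL large `k`):
the conclusion of the crux on off-diagonal real tensors — for EVERY linear isometry `R`, not
only the planar rotations — reduces to the invariance of the ONE-POINT distribution `S₁ 1`,
which `W₁` already makes translation invariant (hence, on paper, `κ · dx`, invariant under
every isometry). -/
theorem apply_linActMulti_eq_of_beta_zero (r : LatticeRep G) (sch : SpeciesScheme (YMSpecies G))
    (hβ : ∃ᶠ k in atTop, sch.β k = 0) {S₁ : SchwingerFamily (EuclideanSpace ℝ (Fin 4))}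
    (htie : ∀ (n : ℕ), n ≠ 0 → ∀ (f : Fin n → 𝓢(EuclideanSpace ℝ (Fin 4), ℝ))
      (F : 𝓢((Fin n → EuclideanSpace ℝ (Fin 4)), ℂ)), IsTensorOf F (fun i => ofRealTest (f i)) →
      IsOffDiagonal F → Tendsto (fun k : ℕ => ((latticeSchwinger r.ρ sch (fun s => s.F) k n
        (fun _ => r.curvature) f : ℝ) : ℂ)) atTop (𝓝 (S₁ n F)))
    (R : EuclideanSpace ℝ (Fin 4) ≃ₗᵢ[ℝ] EuclideanSpace ℝ (Fin 4))
    (h1 : ∀ (g : 𝓢(EuclideanSpace ℝ (Fin 4), ℝ)) (G₁ : 𝓢((Fin 1 → EuclideanSpace ℝ (Fin 4)), ℂ)),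
      IsTensorOf G₁ (fun _ => ofRealTest g) → S₁ 1 (linActMulti R G₁) = S₁ 1 G₁)
    {n : ℕ} (hn : n ≠ 0) (f : Fin n → 𝓢(EuclideanSpace ℝ (Fin 4), ℝ))
    (F : 𝓢((Fin n → EuclideanSpace ℝ (Fin 4)), ℂ)) (hF : IsTensorOf F fun i => ofRealTest (f i))
    (hF' : IsOffDiagonal F) : S₁ n (linActMulti R F) = S₁ n F := by
  choose F₁ hF₁ using fun i => exists_isTensorOf (fun _ : Fin 1 => ofRealTest (f i))
  rw [tie_beta_zero_factorises r sch hβ htie hn f F hF hF' F₁ hF₁,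
    tie_beta_zero_factorises r sch hβ htie hn (fun i => linActTest R (f i)) (linActMulti R F)
      (hF.linActMulti R) (isOffDiagonal_linActMulti hF' R) (fun i => linActMulti R (F₁ i))
      (fun i => (hF₁ i).linActMulti R)]
  exact Finset.prod_congr rfl fun i _ => h1 (f i) (F₁ i) (hF₁ i)

end TieBetaZero


end Summit.QuantumFields.YangMills.Theorems.CurvatureBoostCovariance.Negative

end
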